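import Mathlib
import Summits.RiemannHypothesis.RiemannHypothesis.Theorems.IntegerScrewTheoremB
import Summits.RiemannHypothesis.RiemannHypothesis.Theorems.IntegerScrewPropKKAtom
import HarnessLib

/-!
# Route `IntegerScrew` — the near-extreme cells `(p⁻, R, p)`, `298p ≤ R < p²`: THEOREM B ∧ PROP. K″
# (CONTINUUM-LIMIT §27.3)

THEOREM B (`IntegerScrewTheoremB.theoremB`: `WF² ≤ 3·10⁷·(log R/log(R/p))²·D_𝒜`) and PROP. K″ for the atom
(`IntegerScrewPropKKAtom.propKK_thin_bottom_atom`: `WF² ≤ 2000·e²⁰·G(R)·D_𝒜` when `2e⁵ log(R/p) + 2 ≤ log R − log(R/p)`)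
bound the same window functional of the atom `𝒜 = 𝒜(p⁻, R)` (window `(R/p, R]`, bottom `[1, R/p]`; the bottom's
`p`-smoothness filter is vacuous since `R/p < p`, and `exitMassRatioAtom R (R/p) p = S_W/H_{R/p}`).  Outside the K″
regime `log R/log(R/p) < 2e⁵ + 2`, where THEOREM B's bound is an absolute constant; hence

* **`near_extreme_window_law`** — for `299 ≤ p`, `298p ≤ R < p²` and every `g`:
  `WF² ≤ 2000·e²⁰·(log R + log 4 + e⁵ log(R+1)(log log R + 4))·D_𝒜(g)`,

to be used with `theoremB` as `WF² ≤ min{…}·D_𝒜`: κ(p⁻, R, p) ≤ C·min(log R/ℓ, (ℓ+1)(log log R + 4)), ℓ = log(R/p)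
(CONTINUUM-LIMIT 27.3; the cells R < 298p are PROP. K's `propK`).  RH-free, elementary.
Nothing in this file bears on the truth of RH.
References: CONTINUUM-LIMIT §26–27 (rh-explicit A6-PIVOT); M. Suzuki, J. Lond. Math. Soc. (2) 108 (2023) 1448–1487
[Suzuki2023] for the screw matrices this serves.
-/

noncomputable section

set_option linter.dupNamespace false -- D-0017: `Summit.<S>.<S>.…` is the designed namespace

namespace Summit.RiemannHypothesis.RiemannHypothesis.Theorems.IntegerScrew

open Finset Real
open ArithmeticFunction (vonMangoldt)

/-- The numeric comparison of the two constants: `3·10⁷·(2e⁵+2)² ≤ 2000·e²⁰·44e⁵`. -/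
theorem nearExtreme_const : 30000000 * (2 * Real.exp 5 + 2) ^ 2 ≤ 2000 * Real.exp 20 * (44 * Real.exp 5) := by
  have he5 := Literature.NumberTheory.LFunctions.SiegelZero.HarmFlat.hundred_le_exp_five
  have e20 : Real.exp 20 = (Real.exp 5 * Real.exp 5) * (Real.exp 5 * Real.exp 5) := by
    simp only [← Real.exp_add]; norm_num
  rw [e20]
  have hx0 : 0 ≤ Real.exp 5 := (Real.exp_pos 5).le
  have h1 : (2 * Real.exp 5 + 2) ^ 2 ≤ 9 * (Real.exp 5 * Real.exp 5) := by nlinarith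
  have hx2 : 10000 ≤ Real.exp 5 * Real.exp 5 := by nlinarith
  have hx3 : 1000000 ≤ Real.exp 5 * Real.exp 5 * Real.exp 5 := by nlinarith
  have h2 : 30000000 * (9 * (Real.exp 5 * Real.exp 5)) ≤
      2000 * (Real.exp 5 * Real.exp 5 * (Real.exp 5 * Real.exp 5)) * (44 * Real.exp 5) := by
    have : 30000000 * 9 ≤ 2000 * 44 * (Real.exp 5 * Real.exp 5 * Real.exp 5) := by nlinarith
    nlinarith
  nlinarith

/-- **THEOREM B ∧ PROP. K″ on the near-extreme cells.**  For `299 ≤ p`, `298p ≤ R < p²` and every `g`: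
`(Σ_{W} g x/x − exitMassRatioAtom R (R/p) p·Σ_{b ≤ R/p, p-smooth} g b/b)² ≤ 2000·e²⁰·G(R)·D_{𝒜(p⁻,R)}(g)`. -/
theorem near_extreme_window_law {R p : ℕ} (hp : 299 ≤ p) (hpR : 298 * p ≤ R) (hR : R < p ^ 2) (g : ℕ → ℝ) :
    (∑ x ∈ (Ioc (R / p) R).filter (· ∈ Nat.smoothNumbers p), g x / x -
        exitMassRatioAtom R (R / p) p *
          ∑ b ∈ (Icc 1 (R / p)).filter (· ∈ Nat.smoothNumbers p), g b / b) ^ 2 ≤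
      2000 * Real.exp 20 *
          (Real.log R + Real.log 4 + Real.exp 5 * Real.log ((R : ℝ) + 1) * (Real.log (Real.log R) + 4)) *
        ∑ x ∈ (Icc 1 R).filter (· ∈ Nat.smoothNumbers p),
          (1 / (x : ℝ)) * ∑ n ∈ x.divisors, (vonMangoldt n : ℝ) * (g x - g (x / n)) ^ 2 := by
  have hppos : 0 < p := by omega
  have hRpp : R < p * p := by rw [← pow_two]; exact hR
  have hQ : 298 ≤ R / p := (Nat.le_div_iff_mul_le hppos).2 (by linarith)
  have hQp : R / p < p := (Nat.div_lt_iff_lt_mul hppos).2 hRpp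
  have hR2 : 2 ≤ R := by nlinarith
  -- the bottom filter is vacuous
  have hB : (Icc 1 (R / p)).filter (· ∈ Nat.smoothNumbers p) = Icc 1 (R / p) :=
    Finset.filter_true_of_mem fun b hb => by
      have := Finset.mem_Icc.1 hb; exact Nat.mem_smoothNumbers_of_lt (by omega) (by omega)
  by_cases hreg : 2 * Real.exp 5 * Real.log ((R / p : ℕ) : ℝ) + 2 ≤ Real.log R - Real.log ((R / p : ℕ) : ℝ)
  · have h := propKK_thin_bottom_atom (le_trans (by norm_num) hQ) hRpp hreg g
    unfold exitMassRatioAtom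
    rw [hB]
    exact h
  · have hBthm := theoremB hp hpR hR g
    have hD0 : 0 ≤ ∑ x ∈ (Icc 1 R).filter (· ∈ Nat.smoothNumbers p),
        (1 / (x : ℝ)) * ∑ n ∈ x.divisors, (vonMangoldt n : ℝ) * (g x - g (x / n)) ^ 2 :=
      Finset.sum_nonneg fun x _ => mul_nonneg (by positivity)
        (Finset.sum_nonneg fun n _ => mul_nonneg ArithmeticFunction.vonMangoldt_nonneg (sq_nonneg _))
    refine hBthm.trans (mul_le_mul_of_nonneg_right ?_ hD0)
    -- log R/log(R/p) < 2e⁵ + 2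
    set ℓ := Real.log ((R / p : ℕ) : ℝ) with hℓ
    have hQr : (298 : ℝ) ≤ ((R / p : ℕ) : ℝ) := by exact_mod_cast hQ
    have hℓ1 : 1 ≤ ℓ := by
      rw [hℓ, ← Real.log_exp 1]
      exact Real.log_le_log (Real.exp_pos 1) (by have := Real.exp_one_lt_d9; linarith)
    have hQR' : ((R / p : ℕ) : ℝ) ≤ R := by exact_mod_cast Nat.div_le_self R p
    have hLℓ : ℓ ≤ Real.log R := Real.log_le_log (by linarith) hQR'
    have hlt : Real.log R - ℓ < 2 * Real.exp 5 * ℓ + 2 := lt_of_not_ge hreg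
    have hℓ2 : 2 ≤ ℓ := by
      rw [hℓ, ← Real.log_exp 2]
      refine Real.log_le_log (Real.exp_pos 2) ?_
      have : Real.exp 2 = Real.exp 1 ^ 2 := by rw [← Real.exp_nat_mul]; norm_num
      rw [this]
      have h0 : (0 : ℝ) ≤ Real.exp 1 := (Real.exp_pos 1).le
      have h272 : Real.exp 1 ≤ 2.72 := by have := Real.exp_one_lt_d9; linarith
      have := pow_le_pow_left₀ h0 h272 2
      linarith [show (2.72 : ℝ) ^ 2 ≤ 298 by norm_num]
    have hratio : Real.log R / ℓ ≤ 2 * Real.exp 5 + 2 := by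
      rw [div_le_iff₀ (by linarith)]
      have : (2 * Real.exp 5 + 2) * ℓ = 2 * Real.exp 5 * ℓ + 2 * ℓ := by ring
      rw [this]; linarith
    have hratio0 : 0 ≤ Real.log R / ℓ := div_nonneg (by linarith) (by linarith)
    have hsq : (Real.log R / ℓ) ^ 2 ≤ (2 * Real.exp 5 + 2) ^ 2 := pow_le_pow_left₀ hratio0 hratio 2
    -- G(R) ≥ 44·e⁵
    have he5 := Literature.NumberTheory.LFunctions.SiegelZero.HarmFlat.hundred_le_exp_five
    have hRr : (89102 : ℝ) ≤ R := by exact_mod_cast (show 89102 ≤ R by nlinarith)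
    have hlog11 : (11 : ℝ) ≤ Real.log ((R : ℝ) + 1) := by
      have h1 : Real.exp 11 ≤ (R : ℝ) + 1 := by
        have : Real.exp 11 = Real.exp 1 ^ 11 := by rw [← Real.exp_nat_mul]; norm_num
        rw [this]
        have h0 : (0 : ℝ) ≤ Real.exp 1 := (Real.exp_pos 1).le
        have h272 : Real.exp 1 ≤ 2.72 := by have := Real.exp_one_lt_d9; linarith
        have := pow_le_pow_left₀ h0 h272 11
        have : (2.72 : ℝ) ^ 11 ≤ 89103 := by norm_num
        linarith
      have := Real.log_le_log (Real.exp_pos 11) h1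
      rwa [Real.log_exp] at this
    have hG : 44 * Real.exp 5 ≤
        Real.log R + Real.log 4 + Real.exp 5 * Real.log ((R : ℝ) + 1) * (Real.log (Real.log R) + 4) := by
      have h1 : 0 ≤ Real.log R := Real.log_nonneg (by linarith)
      have h2 : 0 ≤ Real.log 4 := Real.log_nonneg (by norm_num)
      have h3 : 0 ≤ Real.log (Real.log R) := by
        have : 1 ≤ Real.log R := by
          rw [← Real.log_exp 1]
          exact Real.log_le_log (Real.exp_pos 1) (by have := Real.exp_one_lt_d9; linarith)
        exact Real.log_nonneg this
      have h4 : Real.exp 5 * Real.log ((R : ℝ) + 1) * 4 ≤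
          Real.exp 5 * Real.log ((R : ℝ) + 1) * (Real.log (Real.log R) + 4) :=
        mul_le_mul_of_nonneg_left (by linarith) (by positivity)
      nlinarith [Real.exp_pos 5]
    -- 3·10⁷·(2e⁵+2)² ≤ 2000·e²⁰·44e⁵
    have hE20 : 0 ≤ 2000 * Real.exp 20 := by positivity
    calc 30000000 * (Real.log R / ℓ) ^ 2 ≤ 30000000 * (2 * Real.exp 5 + 2) ^ 2 :=
          mul_le_mul_of_nonneg_left hsq (by norm_num)
      _ ≤ 2000 * Real.exp 20 * (44 * Real.exp 5) := nearExtreme_const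
      _ ≤ _ := mul_le_mul_of_nonneg_left hG hE20

end Summit.RiemannHypothesis.RiemannHypothesis.Theorems.IntegerScrew

end
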